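import Summits.PneNP.PneNP.Theorems.ChebyshevTracialDesignTightnessFree
import Summits.PneNP.PneNP.Theorems.ChebyshevTracialDesignProjectionNormalForm
import HarnessLib

/-!
# Cell pnp-psdrank, route `ChebyshevTracialDesign`: the ONE-SIDED (spectral-projection) NORMAL FORM of the crux `TracialDecayExp20`
# — the matching side is eliminated: `sup_Y Σ W tr(X_U Y_M) = Σ_M tr⁺(F_M)`, `F_M = Σ_U W(U,M)·X_U` (crux stmt-PneNP-19878; leaf file)

Brick 86 (prover g16). In the tightness-free form of the crux (brick 84, `…TightnessFree.tracialDecayExp20_iff_contractions`: the value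
`Σ_{U,M} W(U,M)·tr(X_U Y_M)` of a balanced design over ALL pairs of psd-contraction families) the value is AFFINE in each `Y_M` separately and
`Σ_{U,M} W(U,M) tr(X_U Y_M) = Σ_M tr(F_M Y_M)` with the CUT-SIDE VIRTUAL AVERAGE `F_M := Σ_U W(U,M)·X_U` (a symmetric `r × r` matrix depending on
`X` and `M` only). For a symmetric `F`, the maximum of `tr(F Y)` over `0 ⪯ Y ⪯ I` is attained at the spectral projection `P = 1_{(0,∞)}(F)`
and equals the positive spectral part `tr⁺(F) = Σ_i λ_i(F)⁺`:
* §1 `diag_mem_unitInterval`, `contraction_conj`, `trace_conjDiag_mul` — diagonal entries of a contraction lie in `[0,1]`, also after an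
  orthogonal change of basis; `tr(O·diag(x)·Oᵀ·Y) = Σ_i x_i (OᵀYO)_{ii}`;
* §1 **`exists_posProj`** — for symmetric `F` there is an orthogonal projection `P` (`P ⪰ 0`, `I − P ⪰ 0`, `P² = P`) COMMUTING with `F` such that
  `tr(F Y) ≤ tr(F P)` for every `0 ⪯ Y ⪯ I` (eigenbasis from Mathlib's spectral theorem via brick 35b's `exists_eigenbasis`; termwise
  `x_i c_i ≤ x_i⁺` for `c_i ∈ [0,1]`);
* §2 `value_eq_sum_trace_virtualAvg` — `Σ_{U,M} W tr(X_U Y_M) = Σ_M tr(F_M Y_M)`; **`value_le_oneSided`** — for every weight `W` and every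
  symmetric-valued `X` there is a projection-valued `M ↦ P_M`, `P_M` commuting with `F_M`, with `Σ W tr(X_U Y_M) ≤ Σ W tr(X_U P_M)` for ALL
  contraction-valued `Y` (the matching side of an optimal pair is a spectral projection of the cut side's virtual average);
* §3 **`tracialDecayExp20_iff_oneSided`** — hence, BY NAME: `TracialDecayExp20 ↔ ∃ a > 0, ∀ large even n, ∀ balanced B = 20 designs,
  ∀ r ≥ 1 with r²n < exp(a·dq n), ∀ contraction-valued X on the odd cuts, ∀ projection-valued P on the perfect matchings with
  P_M F_M = F_M P_M (F_M = Σ_U W(U,M)·X_U): (1/r)·Σ_{U,M} W(U,M) tr(X_U P_M) ≤ exp(−a·dq n)`.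
So the crux is a statement about ONE contraction field `X : (t-cuts) → [0, I_r]` and the positive spectral part of its virtual averages:
`E_M tr⁺(Ẽ_M[X]) ≤ e^{−aD}·r/|PM|`-normalised (MEMO-19 §1; the `r = 1` shadow reads: for every `f : cuts → [0,1]`, the virtual functional
`M ↦ Σ_U W(U,M) f(U)` has small positive part in `L¹(PM)` — NTF, brick 50c/81). For `X` fixed the symmetrised mean of `F_M` is `−X̄ ⪯ 0`
(`Σ_c w_c = −1`), so positive spectral part can only come from the FLUCTUATION of `M ↦ F_M` exceeding `X̄` in some direction (MEMO-19 §3).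
[cite: Rothvoss2017, §2 (PDF pp. 5–7)] [cite: GriblingDelaatLaurent2019, §5] [cite: BrietDadushPokutta2014, Thm. 6 (§3)]
Stature: support/instrument (a reformulation of the OPEN crux; kernel lane, no defs). WHAT THIS IS NOT: no bound on any value, no proof or
refutation of the crux, nothing on psd rank of P_PM(K_n), no P-vs-NP content.
-/

set_option linter.dupNamespace false -- `Summit.PneNP.PneNP.…`: summit = sub-problem (D-0017)

noncomputable section

namespace Summit.PneNP.PneNP.Theorems.ChebyshevTracialDesignFreeOneSided

open Finset Matrix Literature.Barriers.PneNP Literature.Combinatorics.Optimization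
open Summit.PneNP.PneNP.Theorems.ChebyshevTracialDesignCommutative (posSemidef_conj one_sub_conj conj_mul_conj trace_conj)
open Summit.PneNP.PneNP.Theorems.ChebyshevTracialDesignProjectionNormalForm (exists_eigenbasis)
open Summit.PneNP.PneNP.Theorems.ChebyshevTracialDesignTightnessFree

variable {n r : ℕ}

/-! ### §1 The positive spectral projection maximises `Y ↦ tr(F Y)` over contractions -/

/-- Diagonal entries of a psd contraction lie in `[0, 1]`. [cite: BrietDadushPokutta2014, Thm. 6 (§3)] -/
theorem diag_mem_unitInterval {Y : Matrix (Fin r) (Fin r) ℝ} (hY : Y.PosSemidef ∧ (1 - Y).PosSemidef) (i : Fin r) :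
    0 ≤ Y i i ∧ Y i i ≤ 1 := by
  have h0 : 0 ≤ Y i i := hY.1.diag_nonneg
  have h1 : 0 ≤ (1 - Y) i i := hY.2.diag_nonneg
  rw [Matrix.sub_apply, Matrix.one_apply_eq] at h1
  exact ⟨h0, by linarith⟩

/-- An orthogonal change of basis `Y ↦ OᵀYO` (`OᵀO = I`) preserves psd contractions. [folklore] -/
theorem contraction_conj {Y : Matrix (Fin r) (Fin r) ℝ} (hY : Y.PosSemidef ∧ (1 - Y).PosSemidef) (O : Matrix (Fin r) (Fin r) ℝ)
    (hO : Oᵀ * O = 1) : (Oᵀ * Y * O).PosSemidef ∧ (1 - Oᵀ * Y * O).PosSemidef := by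
  have hO' : Oᵀ * Oᵀᵀ = 1 := by rw [transpose_transpose]; exact hO
  have h0 : (Oᵀ * Y * Oᵀᵀ).PosSemidef := posSemidef_conj hY.1 Oᵀ
  have h1 : (Oᵀ * (1 - Y) * Oᵀᵀ).PosSemidef := posSemidef_conj hY.2 Oᵀ
  rw [← one_sub_conj _ _ hO'] at h1
  rw [transpose_transpose] at h0 h1
  exact ⟨h0, h1⟩

/-- `tr(O·diag(x)·Oᵀ·Y) = Σ_i x_i·(OᵀYO)_{ii}`. [folklore] -/
theorem trace_conjDiag_mul (O : Matrix (Fin r) (Fin r) ℝ) (x : Fin r → ℝ) (Y : Matrix (Fin r) (Fin r) ℝ) :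
    (O * diagonal x * Oᵀ * Y).trace = ∑ i, x i * (Oᵀ * Y * O) i i := by
  calc (O * diagonal x * Oᵀ * Y).trace = ((O * diagonal x) * (Oᵀ * Y)).trace := by simp only [Matrix.mul_assoc]
    _ = ((Oᵀ * Y) * (O * diagonal x)).trace := Matrix.trace_mul_comm _ _
    _ = ((Oᵀ * Y * O) * diagonal x).trace := by simp only [Matrix.mul_assoc]
    _ = ∑ i, x i * (Oᵀ * Y * O) i i := by
        simp only [Matrix.trace, Matrix.diag_apply, Matrix.mul_diagonal]
        exact sum_congr rfl fun i _ => mul_comm _ _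

/-- `tr(O·diag(x)·Oᵀ · O·diag(d)·Oᵀ) = Σ_i x_i d_i` for `OᵀO = I`. [folklore] -/
theorem trace_conjDiag_mul_conjDiag (O : Matrix (Fin r) (Fin r) ℝ) (hO : Oᵀ * O = 1) (x d : Fin r → ℝ) :
    (O * diagonal x * Oᵀ * (O * diagonal d * Oᵀ)).trace = ∑ i, x i * d i := by
  rw [conj_mul_conj _ _ _ hO, trace_conj _ _ hO, diagonal_mul_diagonal, trace_diagonal]

/-- **The positive spectral projection.** For a real symmetric `F` there is an orthogonal projection `P` (`0 ⪯ P`, `0 ⪯ I − P`, `P² = P`)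
commuting with `F` such that `tr(F Y) ≤ tr(F P)` for every psd contraction `Y` — `P = 1_{(0,∞)}(F)`, `tr(F P) = Σ_i λ_i(F)⁺`.
[cite: GriblingDelaatLaurent2019, §5] -/
theorem exists_posProj {F : Matrix (Fin r) (Fin r) ℝ} (hF : F.IsHermitian) :
    ∃ P : Matrix (Fin r) (Fin r) ℝ, (P.PosSemidef ∧ (1 - P).PosSemidef) ∧ P * P = P ∧ P * F = F * P ∧
      ∀ Y : Matrix (Fin r) (Fin r) ℝ, Y.PosSemidef ∧ (1 - Y).PosSemidef → (F * Y).trace ≤ (F * P).trace := by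
  obtain ⟨O, x, hO, hFd⟩ := exists_eigenbasis hF
  have hO' : O * Oᵀ = 1 := mul_eq_one_comm.1 hO
  set d : Fin r → ℝ := fun i => if 0 < x i then 1 else 0 with hd
  have hd01 : ∀ i, d i = 0 ∨ d i = 1 := fun i => by
    by_cases h : 0 < x i
    · exact Or.inr (by simp [hd, h])
    · exact Or.inl (by simp [hd, h])
  have hd0 : ∀ i, 0 ≤ d i := fun i => by rcases hd01 i with h | h <;> norm_num [h]
  have hd1 : ∀ i, 0 ≤ 1 - d i := fun i => by rcases hd01 i with h | h <;> norm_num [h]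
  have hdd : ∀ i, d i * d i = d i := fun i => by rcases hd01 i with h | h <;> norm_num [h]
  refine ⟨O * diagonal d * Oᵀ, ⟨posSemidef_conj (PosSemidef.diagonal hd0) O, ?_⟩, ?_, ?_, fun Y hY => ?_⟩
  · rw [one_sub_conj _ _ hO', ← diagonal_one, diagonal_sub]
    exact posSemidef_conj (PosSemidef.diagonal hd1) O
  · rw [conj_mul_conj _ _ _ hO, diagonal_mul_diagonal, show (fun i => d i * d i) = d from funext hdd]
  · rw [hFd, conj_mul_conj _ _ _ hO, conj_mul_conj _ _ _ hO, diagonal_mul_diagonal, diagonal_mul_diagonal,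
      show (fun i => d i * x i) = fun i => x i * d i from funext fun i => mul_comm _ _]
  · rw [hFd, trace_conjDiag_mul, trace_conjDiag_mul_conjDiag O hO]
    refine sum_le_sum fun i _ => ?_
    obtain ⟨hc0, hc1⟩ := diag_mem_unitInterval (contraction_conj hY O hO) i
    by_cases hx : 0 < x i
    · have : d i = 1 := by simp [hd, hx]
      rw [this, mul_one]
      exact (mul_le_iff_le_one_right hx).2 hc1
    · have : d i = 0 := by simp [hd, hx]
      rw [this, mul_zero]
      exact mul_nonpos_of_nonpos_of_nonneg (not_lt.1 hx) hc0

/-! ### §2 The value as `Σ_M tr(F_M Y_M)` and its one-sided supremum -/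

/-- **The cut-side virtual average.** `Σ_{U,M} W(U,M)·tr(X_U Y_M) = Σ_M tr(F_M Y_M)` with `F_M = Σ_U W(U,M)·X_U`.
[cite: Rothvoss2017, §2 (PDF p. 6)] -/
theorem value_eq_sum_trace_virtualAvg (W : OddSet n → PMatch n → ℝ) (X : OddSet n → Matrix (Fin r) (Fin r) ℝ)
    (Y : PMatch n → Matrix (Fin r) (Fin r) ℝ) :
    ∑ U, ∑ M, W U M * (X U * Y M).trace = ∑ M, ((∑ U, W U M • X U) * Y M).trace := by
  rw [Finset.sum_comm]
  refine sum_congr rfl fun M _ => ?_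
  rw [Finset.sum_mul, trace_sum]
  exact sum_congr rfl fun U _ => by rw [smul_mul_assoc, trace_smul, smul_eq_mul]

/-- The virtual average of a symmetric-valued field is symmetric. [folklore] -/
theorem isHermitian_virtualAvg (W : OddSet n → PMatch n → ℝ) {X : OddSet n → Matrix (Fin r) (Fin r) ℝ}
    (hX : ∀ U, (X U).IsHermitian) (M : PMatch n) : (∑ U, W U M • X U).IsHermitian := by
  unfold IsHermitian
  rw [conjTranspose_sum]
  exact sum_congr rfl fun U _ => by rw [conjTranspose_smul, star_trivial, (hX U).eq]

/-- **ONE-SIDED NORMAL FORM (the matching side is a spectral projection of the cut side's virtual average).** For every weight `W` and every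
symmetric-valued `X` on the odd cuts there is a PROJECTION-valued `P` on the perfect matchings (`0 ⪯ P_M ⪯ I`, `P_M² = P_M`), each `P_M`
commuting with `F_M = Σ_U W(U,M)·X_U`, such that `Σ_{U,M} W tr(X_U Y_M) ≤ Σ_{U,M} W tr(X_U P_M)` for EVERY contraction-valued `Y`; the
right-hand side is `Σ_M tr⁺(F_M)`. [cite: GriblingDelaatLaurent2019, §5] [cite: Rothvoss2017, §2 (PDF pp. 6–7)] -/
theorem value_le_oneSided (W : OddSet n → PMatch n → ℝ) {X : OddSet n → Matrix (Fin r) (Fin r) ℝ}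
    (hX : ∀ U, (X U).IsHermitian) :
    ∃ P : PMatch n → Matrix (Fin r) (Fin r) ℝ, (∀ M, (P M).PosSemidef ∧ (1 - P M).PosSemidef) ∧ (∀ M, P M * P M = P M) ∧
      (∀ M, P M * (∑ U, W U M • X U) = (∑ U, W U M • X U) * P M) ∧
      ∀ Y : PMatch n → Matrix (Fin r) (Fin r) ℝ, (∀ M, (Y M).PosSemidef ∧ (1 - Y M).PosSemidef) →
        ∑ U, ∑ M, W U M * (X U * Y M).trace ≤ ∑ U, ∑ M, W U M * (X U * P M).trace := by
  choose P hPc hPP hPF hPmax using fun M => exists_posProj (isHermitian_virtualAvg W hX M)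
  refine ⟨P, hPc, hPP, hPF, fun Y hY => ?_⟩
  rw [value_eq_sum_trace_virtualAvg, value_eq_sum_trace_virtualAvg]
  exact sum_le_sum fun M _ => hPmax M (Y M) (hY M)

/-! ### §3 The crux in one-sided form -/

/-- **THE CRUX `TracialDecayExp20` IN ONE-SIDED (SPECTRAL-PROJECTION) NORMAL FORM.** `TracialDecayExp20` holds iff, for some `a > 0` and all
large even `n`, for every balanced `B = 20` design weight `W`, every `r ≥ 1` with `r²n < exp(a·dq n)`, every family of psd contractions
`X_U` on the odd cuts and every family of PROJECTIONS `P_M` on the perfect matchings with `P_M F_M = F_M P_M`, `F_M = Σ_U W(U,M)·X_U`: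
`(1/r)·Σ_{U,M} W(U,M)·tr(X_U P_M) ≤ exp(−a·dq n)`. (`→`: a special case of the tightness-free form, brick 84; `←`: by `value_le_oneSided` the
value of any contraction pair `(X, Y)` is at most that of `(X, P)` for the positive spectral projections `P_M` of `F_M`.)
[cite: Rothvoss2017, §2 (PDF pp. 5–7)] [cite: BrietDadushPokutta2014, Thm. 6 (§3)] [cite: GriblingDelaatLaurent2019, §5]
[cite: CoppersmithRivlin1992, Thm. (p. 970)] -/
theorem tracialDecayExp20_iff_oneSided :
    Summit.PneNP.PneNP.Theses.ChebyshevTracialDesign.TracialDecayExp20 ↔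
    ∃ a : ℝ, 0 < a ∧ ∃ n₁ : ℕ, ∀ n : ℕ, n₁ ≤ n → Even n → ∀ (t : ℕ) (C : Finset ℕ) (w : ℕ → ℝ),
      IsBalancedDesign n t (Tq n) (dq n) 20 C w → ∀ r : ℕ, 0 < r → (r : ℝ) ^ 2 * n < Real.exp (a * (dq n : ℝ)) →
        ∀ (X : OddSet n → Matrix (Fin r) (Fin r) ℝ), (∀ U, (X U).PosSemidef ∧ (1 - X U).PosSemidef) →
        ∀ (P : PMatch n → Matrix (Fin r) (Fin r) ℝ), (∀ M, (P M).PosSemidef ∧ (1 - P M).PosSemidef) → (∀ M, P M * P M = P M) →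
          (∀ M, P M * (∑ U, levelWeight n t C w U M • X U) = (∑ U, levelWeight n t C w U M • X U) * P M) →
            (∑ U, ∑ M, levelWeight n t C w U M * (X U * P M).trace) / r ≤ Real.exp (-(a * (dq n : ℝ))) := by
  rw [tracialDecayExp20_iff_contractions]
  constructor
  · rintro ⟨a, ha, n₁, h⟩
    exact ⟨a, ha, n₁, fun n hn hev t C w hdes r hr hbud X hX P hP _ _ => h n hn hev t C w hdes r hr hbud X P hX hP⟩
  · rintro ⟨a, ha, n₁, h⟩
    refine ⟨a, ha, n₁, fun n hn hev t C w hdes r hr hbud X Y hX hY => ?_⟩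
    obtain ⟨P, hPc, hPP, hPF, hPmax⟩ := value_le_oneSided (levelWeight n t C w) fun U => (hX U).1.1
    have hr' : (0 : ℝ) < r := by exact_mod_cast hr
    exact le_trans (div_le_div_of_nonneg_right (hPmax Y hY) hr'.le) (h n hn hev t C w hdes r hr hbud X hX P hPc hPP hPF)

end Summit.PneNP.PneNP.Theorems.ChebyshevTracialDesignFreeOneSided

end
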